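import Literature.MathematicalPhysics.QuantumFieldTheory.Balaban1983to89.B8SectERemainderCovarianceTowerRec
import Literature.MathematicalPhysics.QuantumFieldTheory.Balaban1983to89.B8SectERemainderTraceFree

/-!
# `Balaban1983to89.B8SectERemainderTraceFreeRec` — RECORD TWIN of `B8SectERemainderTraceFree` ([Balaban1985RegularSpaces] (1.115) p. 96 ∕ (1.120) p. 96: the Sect.-E remainder
# `C′_j(u, ·)` of [Balaban1985Averaging] Prop. 10 (213) p. 50 is `τ`-FREE on `τ`-free data for every continuous tracial `τ`, for a `G`-valued background and an `H`-valued
# gauge transformation — joint J-SU, [Balaban1985Averaging] p. 20 «We consider a Lie subgroup G of a unitary group U(N)»; for `M_N(ℂ)`: `G = SU(N)`, `H = SL(N, ℂ)`, `τ = tr`)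
# FOR THE SYMMETRISED CENTRED block averaging (0.4) of [Balaban1987RG1] (`uavgZ ∕ utilGZ ∕ lamAvgGZ ∕ CnlZ ∕ InLambdaZ`)

statement-level skeleton of published theorems with citation tags; proofs where landed; nothing here is a claim about the Yang–Mills mass gap

T. Bałaban, *Spaces of regular gauge field configurations on a lattice and gauge fixing conditions*, Commun. Math. Phys. **99** (1985) 75–102 `[Balaban1985RegularSpaces]`
("[6]"): (1.112)–(1.121) pp. 95–97, (1.115) p. 96, (1.120) p. 96, (1.17) p. 78; T. Bałaban, *Averaging operations for lattice gauge theories*, Commun. Math. Phys. **98** (1985)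
17–51 `[Balaban1985Averaging]` ("[3]"): p. 20, (56)–(58) p. 27, (77)–(80) p. 30, (166)–(167) p. 44, (178)–(179) p. 45, Prop. 10 (203)–(214) p. 50, (211)–(213) p. 50, (21)–(23)
p. 21; T. Bałaban, *Renormalization group approach to lattice gauge field theories. I*, Commun. Math. Phys. **109** (1987) 249–301 `[Balaban1987RG1]` ("[I]"): (0.3)–(0.4)
pp. 252–253.  STATUS: published, refereed.

CITATION HEADER (lean-in-tree rule).  Cell `pub-ymgap`, «N05-REC» R8 = the `G`∕τ-EDITION OF RECORD (desk `R6-PLAN.md` §6 (B)), file T3 — LEAD PEN dag-n05-e g40.  WHAT IS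
REPRODUCED = ✓ the engine module `B8SectERemainderTraceFree` (cell `lit-balaban`, seat `lit-balaban-t2s-1`) VERBATIM under the N05-REC token map of
`B8SectERemainderCovariance(Tower)Rec` (`uavg ∕ R0avg ∕ savg ∕ Sexp ↦ uavgZ ∕ R0avgZ ∕ savgZ ∕ SexpZ` (`B7SectCDGaugeAveragesRec`), `boxVec ↦ offZ`, `avgIter ↦ avgIterZ`,
`Cond167 ∕ InLambda ∕ rlam ∕ lamAvgG ∕ utilG ↦ Cond167Z ∕ InLambdaZ ∕ rlamZ ∕ lamAvgGZ ∕ utilGZ` (`B7SectEFLinearisationRec`), `Cnl ∕ Qnl ↦ CnlZ ∕ QnlZ`, `InAx ∕ Restr129 ∕ glev ↦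
InAxZ ∕ Restr129Z ∕ glevZ`, tower `B8Ineq130 ↦ B8Ineq130Rec` (CENTRED, `block_mem` needs odd `L = 2s+1`), regime `(hL : 2 ≤ L) ↦ (hLs : L = 2s+1) (hs1 : 1 ≤ s)`, `C0 ↦ C0Z`,
`2α₀ ≤ c₂′ ↦ 4α₀ ≤ c₂′`, the witness constant `40d·c ↦ 20dKZ·c` with the record smallness; record inputs `B7Prop2Rec.prop2_explicitZ`, `B7Prop10GeneralRec.{levels_of52Z,
prop10_generalZ_of52}`, `B7Prop10InLambdaRec.inLambdaZ_mul_of_prop10_generalZ`, `B8Eq178AveragesRec.{QnlZ_eq_mlog_utilGZ, qprimeIter_bgTZ_eq_lamAvgGZ, utilGZ_eq_uavgZ_mul_inv}`,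
`B8Eq1115ConcreteRec.{utilGZ_congr_tower, lamAvgGZ_congr_tower}`, `B8SectERemainderCovarianceTowerRec.witness_inv_unitary_of_glev`, `B8Eq1117KLevelRec.glevZ_on_towers_of_axial`):
§1 `apply_lamAvgGZ` (the engine's structure-free `apply_cj` BY NAME); §2 `uavgZ_mem_tower` — `\overline{R₀g}ᵐ(z) ∈ H` on the tower from (H2)∕(H3); §3 `apply_CnlZ_of_witness`, ★ `apply_CnlZ_inv_of_axial` = THE BINDER `hCτ` OF
`B8SectETraceFreeRec` as a theorem: `τ(C′_j(u₁⁻¹, μ)(y)) = 0` for Theorem 4's inductive `u₁` (`H`-valued), a `G`-valued `U₀` (`AvgClosedZ d L G`, `G ≤ H`, `G ≤ U(𝔸)`) and `τ`-free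
`μ`.  Kind «kernel-checked proof», theorems only: no `def`, no `… : Prop` fact, no `instance`, no `notation`, no existing module modified.  `--supports stmt-QuantumFields-20541`
(K0⁷-keyed, COUNT-NEUTRAL).

HONEST SCOPE.  Proofs are the engine's with the record letters; no new analysis; the `M_N(ℂ)` instances of (H2)∕(H3)∕`AvgClosedZ` (`B7Prop2SpecialUnitaryRec`, `B8SpecialLinearTrace`)
are threaded at the crown; the record crown stays CONDITIONAL on the named Cov facts of `B8Ineq159FlatCovPrintedRec` (O-Cov-1 proved p733782; O-Cov-2 pending); `HThm4Rec`
UNDISCHARGED; N05 ∕ N07 NOT discharged; one finite `𝕋⁴` programme at fixed `ε`, Bałaban AS PRINTED; nothing continuum ∕ ℝ⁴ ∕ OS ∕ mass-gap ∕ Clay.  No `sorry`, no `def`.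
-/

noncomputable section

open NormedSpace Finset

namespace Literature.MathematicalPhysics.QuantumFieldTheory.Balaban1983to89.B8SectERemainderTraceFreeRec

open B7Prop1Explicit B7Prop2Explicit B7Prop3Flat B7Prop1Local
open MatrixLog (mlog exp_mlog norm_mlog_le_two_mul)
open B7Eq170Flat (cj cj_apply val_Rc_eq_cj bmean bmean_apply)
open B7Eq92Concrete (Rc Rc_apply mgauge)
open B7Eq99Concrete (R0fun R0fun_apply R0fun_self R0fun_add)
open B7Prop9Flat (C5' SiteBd)
open B7Prop9General (CovBondBd)
open B7Prop10General (C6 C4G)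
open B7Prop10Flat (one_le_C5 C4'_nonneg C5'_nonneg)
open B8Ineq130 (inBox_of_le)
open B8Ineq130Rec (tlo thi tlo_le_thi tlo_zero thi_zero)
open B7Prop2Rec (AvgClosedZ C0Z avgClosedZ_unitaryUnits prop2_explicitZ)
open B7Prop4GeneralLevelsRec (cZ KZ gZ_nonneg)
open BlockAveragingZd (offZ avgIterZ)
open B7SectCDGaugeAveragesRec (SexpZ savgZ R0avgZ uavgZ uavgZ_zero uavgZ_succ glevZ)
open B7Eq99ConcreteRec (SexpZ_apply savgZ_apply)
open B7SectEFLinearisationRec (Cond167Z InLambdaZ rlamZ lamAvgGZ lamAvgGZ_zero lamAvgGZ_succ utilGZ zdBlockingZ bgTZ)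
open B7Prop10GeneralRec (prop10_generalZ_of52 levels_of52Z)
open B7Prop10InLambdaRec (inLambdaZ_mul_of_prop10_generalZ)
open B8Eq1115ConcreteRec (utilGZ_congr_tower lamAvgGZ_congr_tower)
open B8Eq119TwistedAxialRec (InAxZ Restr129Z)
open B8Eq178AveragesRec (QnlZ QnlZ_eq_mlog_utilGZ qprimeIter_bgTZ_eq_lamAvgGZ utilGZ_eq_uavgZ_mul_inv)
open B8Eq1123ConcreteRec (CnlZ)
open B8Eq1117KLevelRec (glevZ_on_towers_of_axial)
open B8SectERemainderCovarianceTowerRec (witness_inv_unitary_of_glev)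
open B8SectERemainderTraceFree (apply_cj)

-- `Site` alone could resolve to the torus sites of `Setup.lean`; re-export the `ℤ^d` sites of `B7Prop1Explicit`.
export B7Prop1Explicit (Site)

variable {d : ℕ}
variable {𝔸 : Type*} [CStarAlgebra 𝔸]
variable (τ : 𝔸 →L[ℂ] ℂ)

/-! ## §1 `τ` through real block means and rotations (centred linear averaging `Q′_j` of record) -/

section Helpers

omit [CStarAlgebra 𝔸] in
/-- Real scalars pass through a `ℂ`-linear functional. [folklore] -/
private theorem apply_real_smul {𝔹 : Type*} [CStarAlgebra 𝔹] (τ : 𝔹 →L[ℂ] ℂ) (c : ℝ) (a : 𝔹) : τ (c • a) = (c : ℂ) • τ a := by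
  rw [RCLike.real_smul_eq_coe_smul (K := ℂ) c a, map_smul]; rfl

/-- **`τ(Q′_jμ) = 0` for `τ`-free `μ`** — the CENTRED linear averaging (211)–(212) of record (`lamAvgGZ`) has real weights and unit rotations (twin of `apply_lamAvgG`).
[cite: Balaban1985Averaging, (211)–(212) p.50, (77) p.30] -/
theorem apply_lamAvgGZ (hτ : ∀ x y : 𝔸, τ (x * y) = τ (y * x)) (L : ℕ) (U₀ : Site d → Fin d → 𝔸ˣ) (f : Site d → 𝔸)
    (hf : ∀ x, τ (f x) = 0) : ∀ (j : ℕ) (z : Site d), τ (lamAvgGZ L U₀ j f z) = 0 := by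
  intro j
  induction j with
  | zero => intro z; rw [lamAvgGZ_zero]; exact hf z
  | succ j ih =>
    intro z
    rw [lamAvgGZ_succ]
    unfold rlamZ
    rw [bmean_apply, map_sum]
    refine sum_eq_zero fun r _ => ?_
    rw [apply_real_smul, apply_cj τ hτ, ih, smul_zero]

end Helpers

/-! ## §2 Local `H`-valuedness of the CENTRED averages (79)–(80) on the tower -/

section Local

variable {H : Subgroup 𝔸ˣ} {L s : ℕ} {U₀c : Site d → Fin d → 𝔸ˣ} {k : ℕ} {g : Site d → 𝔸ˣ} {β η : ℝ} {j : ℕ} {y : Site d}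

/-- **`\overline{R₀g}ᵐ(z) ∈ H` AT THE LEVEL-`m` SITES OF THE TOWER `Bʲ(y)`** from `g(x) ∈ H` on the fine box, `H`-valued averaged levels of the
background, and (167) for `g` (`βLᵏη ≤ ⅛`): (78)/(80) `\overline{R₀g}^{m+1}(z) = v(Lz)·exp[Σ_x L^{−d} log(v(Lz)⁻¹R(Ū₀ᵐ(Γ_{Lz,x}))v(x))]`, `v = \overline{R₀g}ᵐ`,
where each logarithm is of an element of `H` within `⅛` of `1`, hence `τ`-free ((H2)), so the exponential is in `H` ((H3)); induction along the tower
(`B8Ineq130Rec.smul_mem ∕ block_mem`; twin of `uavg_mem_tower`). [cite: Balaban1985Averaging, (78)–(80) p.30, (166)–(167) p.44, p.20] -/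
theorem uavgZ_mem_tower (hH2 : ∀ g ∈ H, ‖(g : 𝔸) - 1‖ ≤ 1 / 8 → τ (mlog (g : 𝔸)) = 0) (hH3 : ∀ S : 𝔸, τ S = 0 → expUnit S ∈ H)
    (hLs : L = 2 * s + 1) (hL : 1 ≤ L) (hVH : ∀ i < k, ∀ (x : Site d) (κ : Fin d), avgIterZ L U₀c i x κ ∈ H)
    (h167 : Cond167Z L U₀c g k β η) (hη : 0 ≤ η) (hβ : 0 ≤ β) (hs : β * (L : ℝ) ^ k * η ≤ 1 / 8)
    (hg : ∀ x : Site d, tlo L y j ≤ x → x ≤ thi L y j → g x ∈ H) :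
    ∀ (m n : ℕ), n + m = j → m ≤ k → ∀ z : Site d, tlo L y n ≤ z → z ≤ thi L y n → uavgZ L U₀c g m z ∈ H
  | 0, n, hn, _, z, hz, hz' => by
    have hnj : n = j := by omega
    subst hnj
    rw [uavgZ_zero]
    exact hg z hz hz'
  | m + 1, n, hmn, hmk, z, hz, hz' => by
    have hLr : (1 : ℝ) ≤ L := by exact_mod_cast hL
    have hmlt : m < k := Nat.lt_of_succ_le hmk
    have ih := uavgZ_mem_tower hH2 hH3 hLs hL hVH h167 hη hβ hs hg m (n + 1) (by omega) hmlt.le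
    obtain ⟨h1, h2⟩ := B8Ineq130Rec.smul_mem hz hz'
    rw [uavgZ_succ, R0avgZ, savgZ_apply, R0fun_self]
    refine H.mul_mem (ih _ h1 h2) (hH3 _ ?_)
    rw [SexpZ_apply, map_sum]
    refine sum_eq_zero fun r _ => ?_
    obtain ⟨h3, h4⟩ := B8Ineq130Rec.block_mem hLs hz hz' r
    rw [apply_real_smul, R0fun_self, R0fun_add]
    have hmem : (uavgZ L U₀c g m ((L : ℤ) • z))⁻¹ *
        Rc (hol (avgIterZ L U₀c m) ((L : ℤ) • z) (treeWord (offZ L r))) (uavgZ L U₀c g m ((L : ℤ) • z + offZ L r)) ∈ H := by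
      refine H.mul_mem (H.inv_mem (ih _ h1 h2)) ?_
      rw [Rc_apply]
      exact H.mul_mem (H.mul_mem (hol_mem_of (hVH m hmlt) _ _) (ih _ h3 h4)) (H.inv_mem (hol_mem_of (hVH m hmlt) _ _))
    have hnorm : ‖((((uavgZ L U₀c g m ((L : ℤ) • z))⁻¹ *
        Rc (hol (avgIterZ L U₀c m) ((L : ℤ) • z) (treeWord (offZ L r))) (uavgZ L U₀c g m ((L : ℤ) • z + offZ L r)) : 𝔸ˣ)) : 𝔸) - 1‖ ≤
        1 / 8 :=
      calc _ ≤ β * (L : ℝ) ^ (m + 1) * η := h167 m hmlt z r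
        _ ≤ β * (L : ℝ) ^ k * η := mul_le_mul_of_nonneg_right (mul_le_mul_of_nonneg_left (pow_le_pow_right₀ hLr hmk) hβ) hη
        _ ≤ 1 / 8 := hs
    rw [hH2 _ hmem hnorm, smul_zero]

end Local

/-! ## §3 On the tower from a `Λ_j`-witness; at `u₁⁻¹` for Theorem 4's inductive `u₁` — record structure -/

section Tower

variable [Nontrivial 𝔸]
variable {G H : Subgroup 𝔸ˣ}
variable {L s : ℕ} {j : ℕ} {y : Site d} {U₀ : Site d → Fin d → 𝔸ˣ} {α₀ α₃ α₄ : ℝ} {μ : Site d → 𝔸} {u ut : Site d → 𝔸ˣ}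

/-- **`τ(C′_j(u, μ)(y′)) = 0` ON THE TOWER FOR ANY `u` WITH A `Λ_j`-WITNESS THAT IS `H`-VALUED ON THE BOX, RECORD STRUCTURE** (twin of `apply_Cnl_of_witness`) — the `τ`-sibling of
`B8SectERemainderCovarianceTowerRec.Cnl_negStar_of_witness`, same data and windows (record constants `20dKZ·c`, `4α₀ ≤ c₂′`): at every level-`m` site `z` of `Bⁿ(y)` (`n + m = j`), for a `τ`-free
`μ` with (207) on `Bʲ(y)`, a `G`-valued `U₀` with (1.33) on `Bʲ(y)` (`G` averaging-closed, `G ≤ H`), `u = ũ` on `Bʲ(y)` with `u` `H`-valued there.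
Proof: for the clamped data `(π^*U₀, μ∘π, ũ)` the averaged levels are `G`-valued (Prop. 2), (167) holds for `ũ` and `e^{μ∘π}ũ` ([3] p. 45) and
(204) for their relative averages (Prop. 10), so `ũ′ᵐ(z) ∈ H` by `uavg_mem_tower` and `τ(log ũ′ᵐ(z)) = 0` by (H2), while `τ(Q′_m(μ∘π)(z)) = 0`
(`apply_lamAvgG`); `C′ = log ũ′ − Q′μ` (213); transfer to the original data by the locality of `ũ′ᵐ` and `Q′_m`.
[cite: Balaban1985RegularSpaces, (1.115) p.96, (1.120) p.96, p.76; Balaban1985Averaging, Prop. 10 p.50, (166)–(167) p.44, (178) p.45, (213) p.50] -/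
theorem apply_CnlZ_of_witness (hτ : ∀ x y : 𝔸, τ (x * y) = τ (y * x))
    (hH2 : ∀ g ∈ H, ‖(g : 𝔸) - 1‖ ≤ 1 / 8 → τ (mlog (g : 𝔸)) = 0) (hH3 : ∀ S : 𝔸, τ S = 0 → expUnit S ∈ H)
    (hG : AvgClosedZ d L G) (hGH : G ≤ H) (hLs : L = 2 * s + 1) (hs1 : 1 ≤ s) (hd : 1 ≤ d) (hU₀ : ∀ x κ, U₀ x κ ∈ G)
    (hα : 0 < α₀) (hα3 : C0Z d * α₀ ≤ 1 / 3) (hα4 : 4 * α₀ ≤ c2' d L)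
    (h33 : pdevOn (tlo L y j) (thi L y j) U₀ < α₀ * (((L : ℝ) ^ j)⁻¹) ^ 2) (hL1 : 1 ≤ L)
    (hW : InLambdaZ L (clampCfg (tlo L y j) (thi L y j) U₀) ut j α₃ (((L : ℝ) ^ j)⁻¹))
    (hu : ∀ x : Site d, tlo L y j ≤ x → x ≤ thi L y j → u x = ut x)
    (huH : ∀ x : Site d, tlo L y j ≤ x → x ≤ thi L y j → u x ∈ H)
    (hμτ : ∀ x, τ (μ x) = 0) (hα₄ : 0 < α₄) (h177b : ∀ x : Site d, InBox (tlo L y j) (thi L y j) x → ‖μ x‖ < α₄)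
    (h177a : ∀ (x : Site d) (κ : Fin d), InBox (tlo L y j) (thi L y j) x → InBox (tlo L y j) (thi L y j) (x + e κ) →
      ‖cj (U₀ x κ) (μ (x + e κ)) - μ x‖ < α₄ * ((L : ℝ) ^ j)⁻¹)
    (hα₃ : 0 ≤ α₃) (hα₃' : α₃ ≤ 1 / 50)
    (hs₁ : 10 * C6 d * (4 * α₄) ≤ 1) (hs₂ : 3000 * ((d : ℝ) + 1) * L * (4 * α₄) ≤ 1) (hs₃ : C4G d L * (α₀ + α₃ + 4 * α₄) ≤ 1)
    (hs₄ : 1024 * ((d : ℝ) + 1) * ((d : ℝ) + 4) * L ^ 2 * α₀ ≤ 1) (hs₅ : 32 * ((d : ℝ) + 1) ^ 2 * C6 d * L ^ 2 * α₀ ≤ 1)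
    (hs₆ : 16 * d * C5' d * C6 d * (L : ℝ) ^ 2 * α₀ ≤ 1)
    (hprod : 2 * C6 d * (α₃ + 4 * α₄) ≤ 1 / 8) (h204w : C6 d * (4 * α₄) ≤ 1 / 8)
    {m n : ℕ} (hmn : n + m = j) (z : Site d) (hz : tlo L y n ≤ z) (hz' : z ≤ thi L y n) :
    τ (CnlZ L U₀ u m μ z) = 0 := by
  have hL : 2 ≤ L := by omega
  have hlohi : ∀ i, tlo L y j i ≤ thi L y j i := tlo_le_thi L le_rfl j
  have hUU : ∀ x κ, U₀ x κ ∈ U1 𝔸 := fun x κ => hG.le_U1 (hU₀ x κ)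
  have hLr : (1 : ℝ) ≤ L := by exact_mod_cast hL1
  have hLj : (0 : ℝ) < (L : ℝ) ^ j := by positivity
  have hC6 : (2 : ℝ) ≤ C6 d := by unfold C6; linarith [one_le_C5 (d := d)]
  have hα₄' : α₄ ≤ 1 / 4 := by nlinarith
  -- the extended data
  set U₀c := clampCfg (tlo L y j) (thi L y j) U₀ with hU₀c_def
  set μc : Site d → 𝔸 := fun x => μ (clamp (tlo L y j) (thi L y j) x) with hμc_def
  have hU₀c : ∀ x κ, U₀c x κ ∈ G := clampCfg_mem hU₀
  have h52c : pdev U₀c < α₀ * (((L : ℝ) ^ j)⁻¹) ^ 2 := (pdev_clampCfg_le hlohi hUU).trans_lt h33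
  have h₀ : AgreeOn (tlo L y j) (thi L y j) U₀ U₀c := (clampCfg_agree U₀).symm
  -- `G`-valued (hence `H`-valued) averaged levels of the clamped background (Prop. 2 of [3])
  have hVH : ∀ i < j, ∀ (x : Site d) (κ : Fin d), avgIterZ L U₀c i x κ ∈ H := fun i hi x κ =>
    hGH ((prop2_explicitZ L hL hG j U₀c hU₀c hα hα3 (by linarith) h52c).2 i hi.le x κ)
  -- (167) for the witness and for the product `e^{μ∘π}·ũ`; (204) for `(e^{μ∘π}, ũ)`
  have hη : (0 : ℝ) ≤ ((L : ℝ) ^ j)⁻¹ := by positivity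
  have hk : (L : ℝ) ^ j * ((L : ℝ) ^ j)⁻¹ ≤ 1 := by rw [mul_inv_cancel₀ hLj.ne']
  obtain ⟨h176, h177⟩ : SiteBd (fun x => expUnit (μc x)) (4 * α₄) ∧ CovBondBd U₀c (fun x => expUnit (μc x)) (4 * α₄ * ((L : ℝ) ^ j)⁻¹) := by
    have hη1 : ((L : ℝ) ^ j)⁻¹ ≤ 1 := inv_le_one_of_one_le₀ (one_le_pow₀ hLr)
    have hb : ∀ x : Site d, ‖μc x‖ < α₄ := fun x => h177b _ (clamp_inBox hlohi x)
    have ha : ∀ (x : Site d) (κ : Fin d), ‖cj (U₀c x κ) (μc (x + e κ)) - μc x‖ < α₄ * ((L : ℝ) ^ j)⁻¹ := by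
      intro x κ
      by_cases hP : tlo L y j κ ≤ x κ ∧ x κ < thi L y j κ
      · have hx := clamp_inBox hlohi x
        have hxe : InBox (tlo L y j) (thi L y j) (clamp (tlo L y j) (thi L y j) x + e κ) := by
          rw [← clamp_add_e_of hP]; exact clamp_inBox hlohi _
        simp only [hμc_def, hU₀c_def, clampCfg, hP, and_self, if_true, clamp_add_e_of hP]
        exact h177a _ κ hx hxe
      · simp only [hμc_def, hU₀c_def, clampCfg, hP, if_false, clamp_add_e_of_not (hlohi κ) hP, cj_apply, Units.val_one, inv_one, one_mul,
          mul_one, sub_self, norm_zero]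
        positivity
    refine ⟨fun x => ?_, fun x κ => ?_⟩
    · show ‖((expUnit (μc x) : 𝔸ˣ) : 𝔸) - 1‖ ≤ 4 * α₄
      rw [val_expUnit]
      exact (B7Eq214.ineq176_of_207 _ hα₄' (hb x)).le
    · show ‖((((expUnit (μc x))⁻¹ * Rc (U₀c x κ) (expUnit (μc (x + e κ))) : 𝔸ˣ)) : 𝔸) - 1‖ ≤ 4 * α₄ * ((L : ℝ) ^ j)⁻¹
      rw [Units.val_mul, val_inv_expUnit, val_Rc_eq_cj, val_expUnit, val_expUnit, cj_apply]
      exact (B7Eq214.ineq177_of_207 _ _ _ hα₄' hη1 (hb x) (ha x κ)).le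
  obtain ⟨hVl, hPl⟩ := levels_of52Z hL hG hU₀c j hα hα3 hα4 h52c
  have hΛprod := inLambdaZ_mul_of_prop10_generalZ hLs hs1 hd (fun i hi => hVl i hi.le) (fun i hi => hPl i hi.le) h176 h177 hW hη hk hα.le hα₃
    hα₃' (by positivity) hs₁ hs₂ hs₃ hs₄ hs₅ hs₆
  have hP10 := prop10_generalZ_of52 hLs hs1 hd hG hU₀c hα hα3 hα4 h52c h176 h177 hW hα₃ hα₃' (by positivity) hs₁ hs₂ hs₃ hs₄ hs₅ hs₆
  have h204 : ∀ i ≤ j, ∀ x : Site d, ‖((utilGZ L U₀c (fun x => expUnit (μc x)) ut i x : 𝔸ˣ) : 𝔸) - 1‖ ≤ 1 / 8 :=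
    fun i hi x => ((hP10 i hi).2 x).trans h204w
  have hsβ : α₃ * (L : ℝ) ^ j * ((L : ℝ) ^ j)⁻¹ ≤ 1 / 8 := by
    rw [mul_assoc, mul_inv_cancel₀ hLj.ne', mul_one]; linarith
  have hsβ' : 2 * C6 d * (α₃ + 4 * α₄) * (L : ℝ) ^ j * ((L : ℝ) ^ j)⁻¹ ≤ 1 / 8 := by
    rw [mul_assoc, mul_inv_cancel₀ hLj.ne', mul_one]; exact hprod
  -- `H`-membership on the box of the witness and of the product `e^{μ∘π}·ũ`
  have hutH : ∀ x : Site d, tlo L y j ≤ x → x ≤ thi L y j → ut x ∈ H := fun x hx hx' => by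
    rw [← hu x hx hx']; exact huH x hx hx'
  have hμcτ : ∀ x, τ (μc x) = 0 := fun x => hμτ _
  have hprodH : ∀ x : Site d, tlo L y j ≤ x → x ≤ thi L y j → ((fun x => expUnit (μc x)) * ut) x ∈ H := fun x hx hx' => by
    rw [Pi.mul_apply]; exact H.mul_mem (hH3 _ (hμcτ x)) (hutH x hx hx')
  -- THE LAW for the clamped data at the tower site `z`: `log ũ′ᵐ(z)` and `Q′_m(μ∘π)(z)` are `τ`-free
  have hglob : τ (CnlZ L U₀c ut m μc z) = 0 := by
    have hW1 : utilGZ L U₀c (fun x => expUnit (μc x)) ut m z ∈ H := by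
      rw [congrFun (utilGZ_eq_uavgZ_mul_inv L U₀c _ ut m) z]
      exact H.mul_mem
        (uavgZ_mem_tower τ hH2 hH3 hLs hL1 hVH hΛprod.2 hη (by positivity) hsβ' hprodH m n hmn (by omega) z hz hz')
        (H.inv_mem (uavgZ_mem_tower τ hH2 hH3 hLs hL1 hVH hW.2 hη hα₃ hsβ hutH m n hmn (by omega) z hz hz'))
    simp only [CnlZ, QnlZ_eq_mlog_utilGZ, qprimeIter_bgTZ_eq_lamAvgGZ, map_sub]
    rw [hH2 _ hW1 (h204 m (by omega) z), apply_lamAvgGZ τ hτ L U₀c μc hμcτ m z, sub_zero]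
  -- transfer to the original data on the tower
  have hC : ∀ {ν νc : Site d → 𝔸}, (∀ x : Site d, tlo L y j ≤ x → x ≤ thi L y j → ν x = νc x) →
      CnlZ L U₀ u m ν z = CnlZ L U₀c ut m νc z := by
    intro ν νc hν
    have hu' : ∀ x : Site d, tlo L y j ≤ x → x ≤ thi L y j → (fun x => expUnit (ν x)) x = (fun x => expUnit (νc x)) x :=
      fun x hx hx' => by simp only [hν x hx hx']
    simp only [CnlZ, QnlZ_eq_mlog_utilGZ]
    rw [qprimeIter_bgTZ_eq_lamAvgGZ L U₀ ν m, qprimeIter_bgTZ_eq_lamAvgGZ L U₀c νc m,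
      utilGZ_congr_tower hLs h₀ hu' hu m n hmn z hz hz', lamAvgGZ_congr_tower hLs h₀ hν m n hmn z hz hz']
  have hμ : ∀ x : Site d, tlo L y j ≤ x → x ≤ thi L y j → μ x = μc x :=
    fun x hx hx' => by simp only [hμc_def, clamp_of_inBox (inBox_of_le hx hx')]
  rw [hC hμ]
  exact hglob

/-- ★ **THE BINDER `hCτ` OF `B8SectETraceFreeRec` AS A THEOREM, RECORD STRUCTURE** (twin of `apply_Cnl_inv_of_axial`) — the `τ`-sibling of `B8SectERemainderCovarianceTowerRec.Cnl_negStar_inv_of_axial`: for Theorem 4's inductive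
`u₁` (`U₁^{u₁}U₀ ∈ Ax_k(𝔅_k, U₀)` and (1.29); `U₁ = e^{B}` unitary-valued with (1.69) on the towers; the full gauge-fixed field's regularity `αP`;
windows as there), a `G`-VALUED background `U₀` (`G` averaging-closed, `G ≤ H`, `G ≤ U(𝔸)`) and an `H`-VALUED `u₁`, where `H` carries (H2) «`τ(log h) = 0`
for `h ∈ H`, `‖h − 1‖ ≤ ⅛`» and (H3) «`e^{S} ∈ H` for `τ`-free `S`» (for `M_N(ℂ)`: `G = SU(N)`, `H = SL(N, ℂ)`, `τ = tr`): at every `j ≤ k`, `y ∈ Λ_j` and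
every `τ`-free `μ` in the (1.120)-set of the tower `Bʲ(y)`, `τ(C′_j(u₁⁻¹, μ)(y)) = 0`.
[cite: Balaban1985RegularSpaces, (1.115) p.96, (1.120) p.96, p.76, (1.112) p.95; Balaban1985Averaging, p.20, Prop. 10 p.50, (213) p.50] -/
theorem apply_CnlZ_inv_of_axial (hτ : ∀ x y : 𝔸, τ (x * y) = τ (y * x))
    (hH2 : ∀ g ∈ H, ‖(g : 𝔸) - 1‖ ≤ 1 / 8 → τ (mlog (g : 𝔸)) = 0) (hH3 : ∀ S : 𝔸, τ S = 0 → expUnit S ∈ H)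
    (hG : AvgClosedZ d L G) (hGH : G ≤ H) (hGu : G ≤ unitaryUnits 𝔸)
    {k : ℕ} (Λ : ℕ → Set (Site d)) {c αP : ℝ} {B : Site d → Fin d → 𝔸} {u₁ : Site d → 𝔸ˣ}
    (hLs : L = 2 * s + 1) (hs1 : 1 ≤ s) (hd : 1 ≤ d) (hL1 : 1 ≤ L) (hU₀ : ∀ x κ, U₀ x κ ∈ G) (hu₁ : ∀ x, u₁ x ∈ H)
    (hα : 0 < α₀) (hα3 : C0Z d * α₀ ≤ 1 / 3) (hα4 : 4 * α₀ ≤ c2' d L) (hc : 0 ≤ c) (hα₄ : 0 < α₄)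
    (hαP : 0 < αP) (hαP3 : C0Z d * αP ≤ 1 / 3) (hαP2 : 2 * αP ≤ c2' d L)
    (hBu : ∀ (x : Site d) (κ : Fin d), expCfg B x κ ∈ unitaryUnits 𝔸)
    (h33 : ∀ j, j ≤ k → ∀ y ∈ Λ j, pdevOn (tlo L y j) (thi L y j) U₀ < α₀ * (((L : ℝ) ^ j)⁻¹) ^ 2)
    (h69 : ∀ j, j ≤ k → ∀ y ∈ Λ j, ∀ (x : Site d) (κ : Fin d), InBox (tlo L y j) (thi L y j) x →
      InBox (tlo L y j) (thi L y j) (x + e κ) → ‖B x κ‖ ≤ c * ((L : ℝ) ^ j)⁻¹)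
    (hP : ∀ j, j ≤ k → ∀ y ∈ Λ j, pdevOn (tlo L y j) (thi L y j) (expCfg B * U₀) < αP * (((L : ℝ) ^ j)⁻¹) ^ 2)
    (hAx : InAxZ L k Λ U₀ (mgauge U₀ u₁ (expCfg B) * U₀)) (h129 : Restr129Z L k Λ U₀ u₁)
    (hsmall : Real.exp (4 * cZ d * α₀) * (1 + 2 * (131072 * ((d : ℝ) + 1) ^ 2) * (KZ d L) ^ 2 * c) ≤ 2)
    (hc₃ : KZ d L * c ≤ c3 d L) (hsc : 1024 * (d : ℝ) * KZ d L * c ≤ 1) (hα₃' : 20 * d * KZ d L * c ≤ 1 / 50)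
    (hs₁ : 10 * C6 d * (4 * α₄) ≤ 1) (hs₂ : 3000 * ((d : ℝ) + 1) * L * (4 * α₄) ≤ 1)
    (hs₃ : C4G d L * (α₀ + 20 * d * KZ d L * c + 4 * α₄) ≤ 1)
    (hs₄ : 1024 * ((d : ℝ) + 1) * ((d : ℝ) + 4) * L ^ 2 * α₀ ≤ 1) (hs₅ : 32 * ((d : ℝ) + 1) ^ 2 * C6 d * L ^ 2 * α₀ ≤ 1)
    (hs₆ : 16 * d * C5' d * C6 d * (L : ℝ) ^ 2 * α₀ ≤ 1)
    (hprod : 2 * C6 d * (20 * d * KZ d L * c + 4 * α₄) ≤ 1 / 8) (h204w : C6 d * (4 * α₄) ≤ 1 / 8) :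
    ∀ j, j ≤ k → ∀ y ∈ Λ j, ∀ μ : Site d → 𝔸, (∀ x, τ (μ x) = 0) →
      (∀ x : Site d, InBox (tlo L y j) (thi L y j) x → ‖μ x‖ < α₄) →
      (∀ (x : Site d) (κ : Fin d), InBox (tlo L y j) (thi L y j) x → InBox (tlo L y j) (thi L y j) (x + e κ) →
        ‖cj (U₀ x κ) (μ (x + e κ)) - μ x‖ < α₄ * ((L : ℝ) ^ j)⁻¹) →
      τ (CnlZ L U₀ u₁⁻¹ j μ y) = 0 := by
  intro j hj y hy μ hμτ hμb hμa
  have hU₀u : ∀ x κ, U₀ x κ ∈ unitaryUnits 𝔸 := fun x κ => hGu (hU₀ x κ)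
  obtain ⟨ut', -, hW, hag⟩ := witness_inv_unitary_of_glev hLs hs1 hd hU₀u hα hα3 hα4 (h33 j hj y hy) hc hsmall hc₃ hsc hαP hαP3 hαP2 hL1
    hBu (h69 j hj y hy) (hP j hj y hy) (glevZ_on_towers_of_axial hLs hL1 Λ hAx h129 j hj y hy)
  have huH : ∀ x : Site d, tlo L y j ≤ x → x ≤ thi L y j → u₁⁻¹ x ∈ H := fun x _ _ => by
    rw [Pi.inv_apply]; exact H.inv_mem (hu₁ x)
  have hy₀ : tlo L y 0 ≤ y := by rw [tlo_zero]
  have hy₀' : y ≤ thi L y 0 := by rw [thi_zero]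
  have hα₃0 : 0 ≤ 20 * (d : ℝ) * KZ d L * c := by
    have hK : 0 ≤ KZ d L := by unfold KZ; have := gZ_nonneg d L; positivity
    positivity
  exact apply_CnlZ_of_witness τ hτ hH2 hH3 hG hGH hLs hs1 hd hU₀ hα hα3 hα4 (h33 j hj y hy) hL1 hW hag huH hμτ hα₄ hμb hμa hα₃0
    hα₃' hs₁ hs₂ hs₃ hs₄ hs₅ hs₆ hprod h204w (m := j) (n := 0) (by omega) y hy₀ hy₀'

end Tower

#print axioms apply_CnlZ_inv_of_axial

end Literature.MathematicalPhysics.QuantumFieldTheory.Balaban1983to89.B8SectERemainderTraceFreeRec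

end
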